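import Summits.Ventures.CertifiedManyBodySolver.Certificates.HubbardSquare_tpm3o10_U29o5_toyKernelCert_pauliRowTBChain
import Summits.Ventures.CertifiedManyBodySolver.Rows.CorrWindowCertKernelChainPack
import HarnessLib

/-!
# STEP-0 of the STAGED replay IN THE DESIGN OF RECORD (packed COMPILED carriers between steps, PLAIN kernel literals materialised by
# `eval%`, source free of accumulator literals): the two-level Pauli toy (`Re ω(1 − n_{0↓}) ≥ 0` at `(1, −3/10, 29/5)`, here read at
# `n₀ = 1`) as a 4-step encoded merge chain — ZERO hypotheses

HONEST FRAMING: a TOY and THE TEMPLATE an exporter-driven instance copies (`Rows/CorrWindowCertKernelChainPack.lean`): per step `i`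
  `def toyL{i+1} : List Chunk := eval% packMany pp 128 (stepE 32 (unpackMany pp toyL{i}) (toySlices.getD i []))` (compiled carrier),
  `noncomputable def toyP{i+1} : EncPoly := eval% unpackMany pp toyL{i+1}` (plain kernel literal),
  `theorem …_step_i : toyPs.getD (i+1) [] = stepE 32 (toyPs.getD i []) (toySlices.getD i []) := eq_of_beq (by decide +kernel)`,
then `ChainOK` by the `Fin 4` pattern match, ONE inequality, `affineOrbitLowerRowN_of_chainKernelCertTB`. MEASURED at CORE size
(probe PACKv2, 29 400 → 38 133 terms: PASS 129 s) where plain compiled literals, textual literals and kernel-side unpacking all fail.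
The slices are those of `…_pauliRowTBChain` (`toySlices`); the node is read at `n₀ = 1` (any `n₀` is sound here since `μ = 0`).
Trust base: the Lean kernel (std axioms). No number of record; no existing claim node discharged; CONTROL/CALIBRATION context
(wording (xx1)); silent on ρ_s = 0 / presence / T_c / phase; nothing about La₂CuO₄; no summit statement is proved by this file.
Seat hubbard-obs-p2 (STIFFNESS), `prover-hubbard-obs-p2-g23-0`, zero compute.

References: J. Wang et al., PRX 14 (2024) 031006 §III [WangEtAl2024]; X. Han, arXiv:2006.06002 §2 eq. (2) [Han2020Bootstrap];
C. Jansson, D. Chaykin, C. Keil, SIAM J. Numer. Anal. 46 (2008) 180 [JanssonChaykinKeil2008].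
-/

namespace Summit.Ventures.CertifiedManyBodySolver

namespace CARPolyWindow

namespace Toy3x3

open Summit.Ventures.CertifiedQuantumChemistry Summit.Ventures.CertifiedQuantumChemistry.CARPoly
open Literature.MathematicalPhysics.QuantumLattice Literature.MathematicalPhysics.QuantumLattice.HubbardWave0
open Literature.MathematicalPhysics.QuantumManyBody.StateRelaxation
open Literature.Probability.LatticeModels ThermodynamicLimit Filter Topology
open Matrix
open scoped ComplexOrder BigOperators
open PackE

/-! ## Carriers (compiled, packed), kernel literals (plain, `eval%`-materialised) and the per-step KERNEL facts -/

/-- Packing parameters shared by all carriers of this chain (generous: numerators `|x| < 2⁶³`, denominators `< 2⁶⁴`). [folklore] -/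
def pp : PackParams := ⟨2 ^ 64, 2 ^ 63, 2 ^ 64⟩

/-- Carrier after step 1: `eval%`, compiled (a few naturals). [folklore] -/
def toyL1 : List Chunk := eval% packMany pp 128 (stepE 32 (unpackMany pp ([] : List Chunk)) (toySlices.getD 0 []))
/-- Carrier after step 2. [folklore] -/
def toyL2 : List Chunk := eval% packMany pp 128 (stepE 32 (unpackMany pp toyL1) (toySlices.getD 1 []))
/-- Carrier after step 3. [folklore] -/
def toyL3 : List Chunk := eval% packMany pp 128 (stepE 32 (unpackMany pp toyL2) (toySlices.getD 2 []))
/-- Carrier after step 4. [folklore] -/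
def toyL4 : List Chunk := eval% packMany pp 128 (stepE 32 (unpackMany pp toyL3) (toySlices.getD 3 []))

/-- Kernel literal after step 1: PLAIN encoded polynomial materialised from the carrier at elaboration (not compiled). [folklore] -/
noncomputable def toyP1 : SOSDual.EncPoly := eval% unpackMany pp toyL1
/-- Kernel literal after step 2. [folklore] -/
noncomputable def toyP2 : SOSDual.EncPoly := eval% unpackMany pp toyL2
/-- Kernel literal after step 3. [folklore] -/
noncomputable def toyP3 : SOSDual.EncPoly := eval% unpackMany pp toyL3
/-- Kernel literal after step 4. [folklore] -/
noncomputable def toyP4 : SOSDual.EncPoly := eval% unpackMany pp toyL4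

/-- The kernel-literal list `[P₀ = [], P₁, P₂, P₃, P₄]`. [folklore] -/
noncomputable def toyPs : List SOSDual.EncPoly := [[], toyP1, toyP2, toyP3, toyP4]

/-- KERNEL FACT, step 1 of 4 (plain literals on both sides; the kernel normal-orders the slice, merges, compares — no unpacking).
[folklore] -/
theorem toyChainP_step_0 : toyPs.getD (0 + 1) [] = stepE 32 (toyPs.getD 0 []) (toySlices.getD 0 []) :=
  eq_of_beq (by decide +kernel)

/-- KERNEL FACT, step 2 of 4. [folklore] -/
theorem toyChainP_step_1 : toyPs.getD (1 + 1) [] = stepE 32 (toyPs.getD 1 []) (toySlices.getD 1 []) :=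
  eq_of_beq (by decide +kernel)

/-- KERNEL FACT, step 3 of 4. [folklore] -/
theorem toyChainP_step_2 : toyPs.getD (2 + 1) [] = stepE 32 (toyPs.getD 2 []) (toySlices.getD 2 []) :=
  eq_of_beq (by decide +kernel)

/-- KERNEL FACT, step 4 of 4. [folklore] -/
theorem toyChainP_step_3 : toyPs.getD (3 + 1) [] = stepE 32 (toyPs.getD 3 []) (toySlices.getD 3 []) :=
  eq_of_beq (by decide +kernel)

/-- **The chain record**, assembled by pattern matching on `Fin 4` (no computation here). [cite: JanssonChaykinKeil2008, §3] -/
theorem toyChainP_ok : ChainOK 32 4 toyPs toySlices where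
  len := by decide +kernel
  step i := match i with
    | ⟨0, _⟩ => toyChainP_step_0
    | ⟨1, _⟩ => toyChainP_step_1
    | ⟨2, _⟩ => toyChainP_step_2
    | ⟨3, _⟩ => toyChainP_step_3
    | ⟨n + 4, h⟩ => absurd h (by omega)

/-- **The ONE rational inequality on the last accumulator**: `0 ≤ lowerConst (decPoly 9 P₄) + 0`, read at `n₀ = 1`.
Decided by the kernel. [cite: WangEtAl2024, §III] -/
theorem toyChainP_lowerConst :
    (0 : ℚ) ≤ lowerConst (SOSDual.decPoly 9 (toyPs.getD 4 [])) + (0 + 0) * ((1 : ℚ) / 2 - 0) := by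
  decide +kernel

/-! ## The end-to-end theorem -/

/-- Membership-proof irrelevance for ordered sites. [folklore] -/
private theorem pt_congr_site₇ {x y : Site 2} (hx : x ∈ W) (hy : y ∈ W) (h : x = y) :
    PolySite.pt x hx = PolySite.pt y hy := by
  subst h; rfl

/-- **STEP-0, staged edition: the affine-N claim-node predicate for `1 − n_{0↓}` at the La214-E station `(1, −3/10, 29/5)`, value `0`,
read at `n₀ = 1`, from the 4-step chain IN THE DESIGN OF RECORD (packed carriers, plain kernel literals) — ZERO hypotheses.** [cite: WangEtAl2024, §III] -/
theorem toyChainP_affineOrbitLowerRowN :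
    SquareTTPrimeCorrAffineOrbitLowerRowN (((-3 / 10 : ℚ)) : ℝ) (((29 / 5 : ℚ)) : ℝ) 0 0 0 0 0 0 1 {1} W (termOp d TXd) := by
  have hz : (0 : Site 2) ∈ W := zero_mem_thicken_zero 1
  have h1 : (1 : DihedralGroup 4) ∈ ({1} : Finset (DihedralGroup 4)) := Finset.mem_singleton_self 1
  have hmul : ∀ a ∈ ({1} : Finset (DihedralGroup 4)), ∀ b ∈ ({1} : Finset (DihedralGroup 4)),
      a * b ∈ ({1} : Finset (DihedralGroup 4)) := by
    intro a ha b hb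
    rw [Finset.mem_singleton] at ha hb ⊢
    rw [ha, hb, mul_one]
  have hΛ : ({0} : Finset (Site 2)) ⊆ W := Finset.singleton_subset_iff.2 hz
  have hix0 : xs (ix 0) = 0 := xs_ix_of_mem 0 hz
  have ho : ∀ σ : Fin 2, d (orb (ix 0) σ) = orb (PolySite.pt 0 hz) σ := by
    intro σ
    rw [d_orb, pt_congr_site₇ (xs_mem (ix 0)) hz hix0]
  have hH : termOp d TH = (hubbardTTPrimeFermionInteraction 1 (((-3 / 10 : ℚ)) : ℝ) (((29 / 5 : ℚ)) : ℝ)).localHamiltonian W := by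
    rw [TH, termOp_hamTermsIdx 1 (-3 / 10) (29 / 5) xs xs_mem xs_injective xs_cover d d_orb, Rat.cast_one]
  have hE : termOp d TE = fermionEmbed (PolySite.incl (subset_refl W))
      ((hubbardTTPrimeFermionInteraction 1 (((-3 / 10 : ℚ)) : ℝ) (((29 / 5 : ℚ)) : ℝ)).meanEnergyObs 1) := by
    rw [TE, termOp_energyTermsIdx 1 (-3 / 10) (29 / 5) xs xs_mem (subset_refl W) ix xs_ix_of_mem d d_orb, Rat.cast_one]
  exact affineOrbitLowerRowN_of_chainKernelCertTB (-3 / 10) (29 / 5) (by norm_num) hΛ (subset_refl W) (subset_refl W) hz h1 hmul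
    d d_injective 32 (fun b : Fin 0 => b.elim0) (fun b : Fin 0 => b.elim0) (fun b => b.elim0)
    (fun p => (ofLex p).2) (fun _ => rfl) TH hH TE hE (fun σ => orb (ix 0) σ) ho TXd (fun _ => 0) 0 0 0 0 0 1 blocksd []
    (fun l : Fin 0 => l.elim0) (fun l => l.elim0) (fun l : Fin 0 => l.elim0) (fun l : Fin 0 => l.elim0)
    (fun l => l.elim0) (fun l => l.elim0) (fun l : Fin 0 => l.elim0) [] (fun wc hwc => absurd hwc (List.not_mem_nil)) []
    [1, 2, 2] 4 toyPs rfl toyChainP_ok (by norm_num) toyChainP_lowerConst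

end Toy3x3

end CARPolyWindow

end Summit.Ventures.CertifiedManyBodySolver
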